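import Literature.NumberTheory.Automorphic.UnitaryGroupOrbitalMeasureFamilyOfLocal      -- ★ `OrbitalMeasureFamily.atPoint`, `orbitalIntegral_atPoint`
import Literature.NumberTheory.Automorphic.LocalOrbitalMeasure                        -- ★ `isClosed_coe_centralizer_singleton`
import Literature.NumberTheory.Automorphic.OrbitalIntegralCentralTransport            -- ★ `integral_descConj_quotientMeasure_eq_of_mulEquiv`
import Literature.NumberTheory.Automorphic.UnitaryGroupOrbitalMeasureOfLocalQuotient  -- ★ `isHaarMeasure_map_subgroupCongrHomeomorph`, `isInvInvariant_map_subgroupCongrHomeomorph`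
import Literature.MeasureTheory.Group.InvariantQuotientCompactSubgroup               -- ★ `integral_quotientMeasure_eq_inv_smul`
import HarnessLib

/-!
# Singular orbital integrals of Weil-form families: compact centralisers and transport along a group isomorphism
(generic layer of the ROAD-Sd junction (δ′) «(L-st) SINGULAR HALF AT ONE INDEFINITE PLACE»; Rogawski 1990 §4.3 (4.3.1), §8.2 p. 123; Deitmar–Echterhoff Thm. 1.5.3)

Topic `NumberTheory/Automorphic`; namespace `Literature.NumberTheory.Automorphic`.  THEOREMS ONLY (no `def`, no instance, no notation, no axiom, no named fact, no
`sorry`).  Cell `pub/hodgecm-mathlib`, ENGINE T1 (crux H413 = `stmt-HodgeConjecture-24833`); floor-1, count-neutral; LEAD WORD T8-51 (B) ∕ T8-52; census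
`CENSUS-delta-prime-LstSingularHalf` a6407579; author F0P3a-p03 (g10).  Consumer: ★-to-be `Rogawski1990/ArchStableTorusOrbitalWallSingularTerms` (the archimedean carrier).

For an orbital-measure family `m` on a locally compact group in WEIL FORM at a point `γ` (`m.atPoint γ = dν ∕ dρ`, `ρ` an inversion-invariant Haar measure on `Z(γ)` — the shape
★ `OrbitalMeasureFamily.IsQuotientOf` ∕ the (K7-s) ⟹ (D1) PIN deliver), the class orbital integral `Φ(⟦γ⟧, f; m) = classOrbitalIntegral m f ⟦γ⟧` is compared with the two
GROUP-CURRENCY expressions print uses at singular points [Rogawski1990 §8.2 pp. 122–124]: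
* (G1) COMPACT CENTRALISER: `∫_G f(x γ x⁻¹) dν = ρ(Z(γ)) · Φ(⟦γ⟧, f; m)` (★ `integral_quotientMeasure_eq_inv_smul`, ★ `orbitalIntegral_atPoint`);
* (G2a–c) TRANSPORT ALONG `e : G ≃* G'` (an isomorphism of topological groups; `H ≤ G` closed, centralising `γ`, with `e(H) = Z(e γ)`): the singular orbital integral
  `∫_{G ⧸ H} f(e(y γ y⁻¹)) d((e⁻¹)_* ν ∕ νH)` is the orbital integral of `f` at `e γ` against `ν ∕ (e|_H)_* νH` (★ `integral_descConj_quotientMeasure_eq_of_mulEquiv`), hence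
  `Φ(⟦e γ⟧, f; m)` for a COMPATIBLE family (`m.atPoint (e γ) = ν ∕ (e|_H)_* νH`), and — PULL-BACK FORM — for ANY Weil-form family when the source torus measure is taken to be
  `(e|_H)⁻¹_* ρ` (its Haar ∕ inversion invariance supplied).
HONEST LABEL: HC_CM is proved only modulo the printed citations until rung 0 closes; this file pays nothing by itself.

## References
* [Rogawski1990] J. D. Rogawski, *Automorphic Representations of Unitary Groups in Three Variables*, Ann. of Math. Stud. 123 (1990), §4.3 (4.3.1) p. 43, §1.7 p. 6, §8.2 p. 123.
* [DeitmarEchterhoff2014] A. Deitmar, S. Echterhoff, *Principles of Harmonic Analysis*, 2nd ed. (2014), Thm. 1.5.3, Cor. 1.5.4.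
* [Folland1995] G. B. Folland, *A Course in Abstract Harmonic Analysis* (1995), §2.6 (2.52).
-/

set_option autoImplicit false

noncomputable section

open MeasureTheory Measure
open Literature.MeasureTheory.Group Literature.NumberTheory.Automorphic.UnitaryGroup
open scoped NNReal

/-! ## §1 Generic -/

namespace Literature.NumberTheory.Automorphic

section CompactCentralizer

variable {G : Type*} [Group G] [TopologicalSpace G] [IsTopologicalGroup G] [LocallyCompactSpace G]
  [SecondCountableTopology G] [T2Space G] [MeasurableSpace G] [BorelSpace G]
  [∀ γ : G, MeasurableSpace (G ⧸ Subgroup.centralizer ({γ} : Set G))]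
  [∀ γ : G, BorelSpace (G ⧸ Subgroup.centralizer ({γ} : Set G))]

/-- **(G1) A FULL-GROUP CONJUGATION INTEGRAL AT A POINT WITH COMPACT CENTRALISER IS THE CENTRALISER MASS TIMES THE CLASS ORBITAL INTEGRAL** of a Weil-form family:
`∫_G f(x γ x⁻¹) dν(x) = ρ(Z(γ)) · Φ(⟦γ⟧, f; m)` when `m.atPoint γ = dν ∕ dρ` and `Z(γ)` is compact (★ `integral_quotientMeasure_eq_inv_smul`: `∫_{G⧸Z} F d(ν∕ρ) = ρ(Z)⁻¹ ∫_G F∘π dν`).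
This is the compact-wall term of ★ J1 (print's `γ₂ → γ₀′`, centraliser `U(2) × U(1)`) in the closer's currency. [cite: Rogawski1990, §8.2 p. 123; §4.3 (4.3.1) p. 43]
[cite: Folland1995, §2.6 (2.52)] [cite: DeitmarEchterhoff2014, Cor. 1.5.4] -/
theorem OrbitalMeasureFamily.integral_comp_conj_eq_measureReal_mul_classOrbitalIntegral_of_atPoint_eq (m : OrbitalMeasureFamily G) (γ : G)
    [SMulInvariantMeasure G (G ⧸ Subgroup.centralizer ({(Quotient.out (ConjClasses.mk γ) : G)} : Set G)) (m (ConjClasses.mk γ))]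
    [CompactSpace (Subgroup.centralizer ({γ} : Set G))]
    {ν : Measure G} [ν.IsHaarMeasure] [ν.IsMulRightInvariant]
    {ρ : Measure (Subgroup.centralizer ({γ} : Set G))} [ρ.IsHaarMeasure] [ρ.IsInvInvariant]
    (hq : m.atPoint γ = quotientMeasure (Subgroup.centralizer ({γ} : Set G)) ρ (isClosed_coe_centralizer_singleton γ) ν)
    {f : G → ℂ} (hf : Measurable f) :
    ∫ x, f (x * γ * x⁻¹) ∂ν = (ρ.real Set.univ : ℂ) * classOrbitalIntegral m f (ConjClasses.mk γ) := by
  haveI : IsClosed ((Subgroup.centralizer ({γ} : Set G) : Subgroup G) : Set G) := isClosed_coe_centralizer_singleton γ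
  have hρ0 : (ρ.real Set.univ : ℂ) ≠ 0 := by
    rw [Ne, Complex.ofReal_eq_zero, Measure.real, ENNReal.toReal_eq_zero_iff, not_or]
    exact ⟨(isOpen_univ.measure_pos ρ Set.univ_nonempty).ne', isCompact_univ.measure_lt_top.ne⟩
  rw [← m.orbitalIntegral_atPoint γ f, hq, orbitalIntegral_eq_integral_descConj,
    integral_quotientMeasure_eq_inv_smul (Subgroup.centralizer ({γ} : Set G)) ρ ν _
      (measurable_descConj γ _ _ hf).stronglyMeasurable]
  simp only [descConj_mk, Complex.real_smul, Complex.ofReal_inv]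
  rw [mul_inv_cancel_left₀ hρ0]

end CompactCentralizer

section Transport

variable {G G' : Type*} [Group G] [Group G'] [TopologicalSpace G] [TopologicalSpace G']
  [IsTopologicalGroup G] [IsTopologicalGroup G'] [LocallyCompactSpace G] [LocallyCompactSpace G']
  [SecondCountableTopology G] [SecondCountableTopology G'] [T2Space G] [T2Space G']
  [MeasurableSpace G] [BorelSpace G] [MeasurableSpace G'] [BorelSpace G']
  [∀ γ' : G', MeasurableSpace (G' ⧸ Subgroup.centralizer ({γ'} : Set G'))]
  [∀ γ' : G', BorelSpace (G' ⧸ Subgroup.centralizer ({γ'} : Set G'))]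
  (e : G ≃* G') (he : Continuous e) (hes : Continuous e.symm)
  {γ : G} {γ' : G'}
  (H : Subgroup G) (hH : IsClosed (H : Set G)) (hHγ : ∀ g ∈ H, g * γ = γ * g)
  (hHH' : ∀ g, e g ∈ Subgroup.centralizer ({γ'} : Set G') ↔ g ∈ H)
  [MeasurableSpace (G ⧸ H)] [BorelSpace (G ⧸ H)]
  (νH : Measure H) [νH.IsHaarMeasure] [νH.IsInvInvariant]
  (ν : Measure G') [ν.IsHaarMeasure] [ν.IsMulRightInvariant]

/-- **(G2a) TRANSPORT OF A SINGULAR ORBITAL INTEGRAL TO THE TARGET GROUP, AS AN ORBITAL INTEGRAL AT `e γ`.** For an isomorphism of topological groups `e : G ≃* G'`, a closed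
`H ≤ G` centralising `γ` with `e(H) = Z(e γ)`, a Haar measure `νH` on `H` and a Haar measure `ν` on the TARGET:
`∫_{G ⧸ H} f(e(y γ y⁻¹)) d((e⁻¹)_* ν ∕ νH) = O_{eγ}(f; ν ∕ (e|_H)_* νH)` (★ `integral_descConj_quotientMeasure_eq_of_mulEquiv` with `ν' = e_* (e⁻¹)_* ν = ν`). [cite: DeitmarEchterhoff2014, Thm. 1.5.3]
[cite: Rogawski1990, §4.3 (4.3.1) p. 43] -/
theorem integral_descConj_quotientMeasure_map_symm_eq_orbitalIntegral (hγ : e γ = γ')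
    [(ν.map e.symm).IsHaarMeasure] [(ν.map e.symm).IsMulRightInvariant]
    (νH' : Measure (Subgroup.centralizer ({γ'} : Set G'))) [νH'.IsHaarMeasure] [νH'.IsInvInvariant]
    (hνH' : νH' = νH.map (subgroupCongrHomeomorph e H (Subgroup.centralizer ({γ'} : Set G')) hHH' he hes)) (f : G' → ℂ) :
    ∫ y, descConj γ H hHγ (fun k => f (e k)) y ∂(quotientMeasure H νH hH (ν.map e.symm)) =
      orbitalIntegral γ' f (quotientMeasure (Subgroup.centralizer ({γ'} : Set G')) νH' (isClosed_coe_centralizer_singleton γ') ν) := by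
  haveI : LocallyCompactSpace H := hH.isClosedEmbedding_subtypeVal.locallyCompactSpace
  haveI : LocallyCompactSpace (Subgroup.centralizer ({γ'} : Set G')) := (isClosed_coe_centralizer_singleton γ').isClosedEmbedding_subtypeVal.locallyCompactSpace
  haveI : IsClosed (H : Set G) := hH
  haveI : IsClosed ((Subgroup.centralizer ({γ'} : Set G') : Subgroup G') : Set G') := isClosed_coe_centralizer_singleton γ'
  have hν : ν = (ν.map e.symm).map e := by
    rw [Measure.map_map he.measurable hes.measurable]
    have : ((e : G → G') ∘ (e.symm : G' → G)) = id := funext fun x => e.apply_symm_apply x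
    rw [this, Measure.map_id]
  rw [orbitalIntegral_eq_integral_descConj]
  exact (integral_descConj_quotientMeasure_eq_of_mulEquiv e he hes H (Subgroup.centralizer ({γ'} : Set G')) hHH' νH νH' (ν.map e.symm) ν
    hνH' hν hγ hHγ (fun _ hg => Subgroup.mem_centralizer_singleton_iff.1 hg) f).symm

/-- **(G2b) … HENCE THE CLASS ORBITAL INTEGRAL OF A COMPATIBLE WEIL-FORM FAMILY ON THE TARGET**: if `m.atPoint (e γ) = ν ∕ (e|_H)_* νH`, then
`∫_{G ⧸ H} f(e(y γ y⁻¹)) d((e⁻¹)_* ν ∕ νH) = Φ(⟦e γ⟧, f; m)` (★ `orbitalIntegral_atPoint`). [cite: DeitmarEchterhoff2014, Thm. 1.5.3] [cite: Rogawski1990, §4.3 (4.3.1) p. 43; §1.7 p. 6] -/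
theorem OrbitalMeasureFamily.integral_descConj_quotientMeasure_map_symm_eq_classOrbitalIntegral_of_atPoint_eq (hγ : e γ = γ')
    [(ν.map e.symm).IsHaarMeasure] [(ν.map e.symm).IsMulRightInvariant]
    (m : OrbitalMeasureFamily G')
    [SMulInvariantMeasure G' (G' ⧸ Subgroup.centralizer ({(Quotient.out (ConjClasses.mk γ') : G')} : Set G')) (m (ConjClasses.mk γ'))]
    (νH' : Measure (Subgroup.centralizer ({γ'} : Set G'))) [νH'.IsHaarMeasure] [νH'.IsInvInvariant]
    (hνH' : νH' = νH.map (subgroupCongrHomeomorph e H (Subgroup.centralizer ({γ'} : Set G')) hHH' he hes))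
    (hq : m.atPoint γ' = quotientMeasure (Subgroup.centralizer ({γ'} : Set G')) νH' (isClosed_coe_centralizer_singleton γ') ν) (f : G' → ℂ) :
    ∫ y, descConj γ H hHγ (fun k => f (e k)) y ∂(quotientMeasure H νH hH (ν.map e.symm)) = classOrbitalIntegral m f (ConjClasses.mk γ') := by
  rw [← m.orbitalIntegral_atPoint γ' f, hq]
  exact integral_descConj_quotientMeasure_map_symm_eq_orbitalIntegral e he hes H hH hHγ hHH' νH ν hγ νH' hνH' f

omit [LocallyCompactSpace G] [SecondCountableTopology G] [SecondCountableTopology G'] [T2Space G]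
  [∀ γ' : G', MeasurableSpace (G' ⧸ Subgroup.centralizer ({γ'} : Set G'))] [∀ γ' : G', BorelSpace (G' ⧸ Subgroup.centralizer ({γ'} : Set G'))]
  [MeasurableSpace (G ⧸ H)] [BorelSpace (G ⧸ H)] in
/-- The torus measure PULLED BACK from the target, `(e|_H)⁻¹_* ρ`, is a Haar measure on `H`. [cite: DeitmarEchterhoff2014, Thm. 1.5.3] -/
theorem isHaarMeasure_map_subgroupCongrHomeomorph_symm (ρ : Measure (Subgroup.centralizer ({γ'} : Set G'))) [ρ.IsHaarMeasure] :
    (ρ.map (subgroupCongrHomeomorph e H (Subgroup.centralizer ({γ'} : Set G')) hHH' he hes).symm).IsHaarMeasure := by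
  haveI : LocallyCompactSpace (Subgroup.centralizer ({γ'} : Set G')) := (isClosed_coe_centralizer_singleton γ').isClosedEmbedding_subtypeVal.locallyCompactSpace
  have h := isHaarMeasure_map_subgroupCongrHomeomorph e.symm hes he (Subgroup.centralizer ({γ'} : Set G')) H (forall_symm_mem_iff e H _ hHH') ρ
  have hfun : (⇑(subgroupCongrHomeomorph e.symm (Subgroup.centralizer ({γ'} : Set G')) H (forall_symm_mem_iff e H _ hHH') hes he) :
      Subgroup.centralizer ({γ'} : Set G') → H) = ⇑(subgroupCongrHomeomorph e H (Subgroup.centralizer ({γ'} : Set G')) hHH' he hes).symm := by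
    funext x; rfl
  rwa [hfun] at h

omit [LocallyCompactSpace G] [LocallyCompactSpace G'] [SecondCountableTopology G] [SecondCountableTopology G'] [T2Space G] [T2Space G']
  [∀ γ' : G', MeasurableSpace (G' ⧸ Subgroup.centralizer ({γ'} : Set G'))] [∀ γ' : G', BorelSpace (G' ⧸ Subgroup.centralizer ({γ'} : Set G'))]
  [MeasurableSpace (G ⧸ H)] [BorelSpace (G ⧸ H)] in
/-- The pulled-back torus measure is inversion invariant. [cite: DeitmarEchterhoff2014, Thm. 1.5.3] -/
theorem isInvInvariant_map_subgroupCongrHomeomorph_symm (ρ : Measure (Subgroup.centralizer ({γ'} : Set G'))) [ρ.IsInvInvariant] :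
    (ρ.map (subgroupCongrHomeomorph e H (Subgroup.centralizer ({γ'} : Set G')) hHH' he hes).symm).IsInvInvariant := by
  have h := isInvInvariant_map_subgroupCongrHomeomorph e.symm hes he (Subgroup.centralizer ({γ'} : Set G')) H (forall_symm_mem_iff e H _ hHH') ρ
  have hfun : (⇑(subgroupCongrHomeomorph e.symm (Subgroup.centralizer ({γ'} : Set G')) H (forall_symm_mem_iff e H _ hHH') hes he) :
      Subgroup.centralizer ({γ'} : Set G') → H) = ⇑(subgroupCongrHomeomorph e H (Subgroup.centralizer ({γ'} : Set G')) hHH' he hes).symm := by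
    funext x; rfl
  rwa [hfun] at h

/-- **(G2c) THE PULL-BACK FORM**: for ANY Weil-form family at `e γ` (`m.atPoint (e γ) = dν ∕ dρ`, `ρ` any inversion-invariant Haar measure on `Z(e γ)` — the shape of the
(K7-s) ⟹ (D1) PIN), the source singular orbital integral against the PULLED-BACK torus measure `(e|_H)⁻¹_* ρ` is the class orbital integral:
`∫_{G ⧸ H} f(e(y γ y⁻¹)) d((e⁻¹)_* ν ∕ (e|_H)⁻¹_* ρ) = Φ(⟦e γ⟧, f; m)` — no compatibility constant. [cite: DeitmarEchterhoff2014, Thm. 1.5.3] [cite: Rogawski1990, §4.3 (4.3.1) p. 43; §1.7 p. 6] -/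
theorem OrbitalMeasureFamily.integral_descConj_quotientMeasure_map_symm_pullback_eq_classOrbitalIntegral_of_atPoint_eq (hγ : e γ = γ')
    [(ν.map e.symm).IsHaarMeasure] [(ν.map e.symm).IsMulRightInvariant]
    (m : OrbitalMeasureFamily G')
    [SMulInvariantMeasure G' (G' ⧸ Subgroup.centralizer ({(Quotient.out (ConjClasses.mk γ') : G')} : Set G')) (m (ConjClasses.mk γ'))]
    (ρ : Measure (Subgroup.centralizer ({γ'} : Set G'))) [ρ.IsHaarMeasure] [ρ.IsInvInvariant]
    (hq : m.atPoint γ' = quotientMeasure (Subgroup.centralizer ({γ'} : Set G')) ρ (isClosed_coe_centralizer_singleton γ') ν)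
    [(ρ.map (subgroupCongrHomeomorph e H (Subgroup.centralizer ({γ'} : Set G')) hHH' he hes).symm).IsHaarMeasure]
    [(ρ.map (subgroupCongrHomeomorph e H (Subgroup.centralizer ({γ'} : Set G')) hHH' he hes).symm).IsInvInvariant] (f : G' → ℂ) :
    ∫ y, descConj γ H hHγ (fun k => f (e k)) y
        ∂(quotientMeasure H (ρ.map (subgroupCongrHomeomorph e H (Subgroup.centralizer ({γ'} : Set G')) hHH' he hes).symm) hH (ν.map e.symm)) =
      classOrbitalIntegral m f (ConjClasses.mk γ') := by
  refine m.integral_descConj_quotientMeasure_map_symm_eq_classOrbitalIntegral_of_atPoint_eq e he hes H hH hHγ hHH' _ ν hγ ρ ?_ hq f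
  rw [Measure.map_map (subgroupCongrHomeomorph e H _ hHH' he hes).continuous.measurable (subgroupCongrHomeomorph e H _ hHH' he hes).symm.continuous.measurable]
  have : ((⇑(subgroupCongrHomeomorph e H (Subgroup.centralizer ({γ'} : Set G')) hHH' he hes)) ∘
      (⇑(subgroupCongrHomeomorph e H (Subgroup.centralizer ({γ'} : Set G')) hHH' he hes).symm)) = id :=
    funext fun x => (subgroupCongrHomeomorph e H _ hHH' he hes).apply_symm_apply x
  rw [this, Measure.map_id]

end Transport

end Literature.NumberTheory.Automorphic



end
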